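import Summits.ValiantsHypothesis.ValiantsHypothesis.Theses.FreeFermionCLL
import Summits.ValiantsHypothesis.ValiantsHypothesis.Theses.PrincipalMinorColouring

/-!
# ValiantsHypothesis — `QpArith` (quasi-polynomial arithmetic glue)

Item `stmt-ValiantsHypothesis-3785` (support, rank 9), shared verbatim by the routes
`FreeFermionCLL` and `PrincipalMinorColouring`:

`∀ c, ∃ c', ∀ n, n ^ 2 * 2 ^ ((Nat.log 2 n + c) ^ c) ≤ 2 ^ ((Nat.log 2 n + c') ^ c')`,

i.e. a polynomial factor `n²` is absorbed into a quasi-polynomial bound by raising the constant.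
We take `c' = c + 2`.  With `L = Nat.log 2 n` one has `n < 2 ^ (L + 1)`, hence
`n ^ 2 ≤ 2 ^ (2L + 2)`, and the exponent inequality
`(L + c) ^ c + (2L + 2) ≤ (L + c + 2) ^ (c + 2)` follows from
`(L + c) ^ c ≤ (L + c + 2) ^ c`, `1 ≤ (L + c + 2) ^ c` and `2L + 3 ≤ (L + c + 2) ^ 2`.
Elementary; no literature input (the route cites Bürgisser 2000 only for the notion of
quasi-polynomial boundedness).
-/

namespace Summit.ValiantsHypothesis.ValiantsHypothesis.Theorems

/-- Exponent bookkeeping: `(L + c) ^ c + (2L + 2) ≤ (L + c + 2) ^ (c + 2)` for all naturals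
`L, c`. -/
theorem qpArith_exponent_le (L c : ℕ) :
    (L + c) ^ c + (2 * L + 2) ≤ (L + c + 2) ^ (c + 2) := by
  have h1 : (L + c) ^ c ≤ (L + c + 2) ^ c := Nat.pow_le_pow_left (Nat.le_add_right _ _) c
  have h2 : 1 ≤ (L + c + 2) ^ c := Nat.one_le_pow _ _ (by omega)
  have h3 : 2 * L + 3 ≤ (L + c + 2) ^ 2 := by
    calc 2 * L + 3 ≤ (L + 2) * (L + 2) := by nlinarith [Nat.zero_le (L * L)]
      _ ≤ (L + c + 2) * (L + c + 2) := Nat.mul_le_mul (by omega) (by omega)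
      _ = (L + c + 2) ^ 2 := (sq _).symm
  calc (L + c) ^ c + (2 * L + 2)
      ≤ (L + c + 2) ^ c + (L + c + 2) ^ c * (2 * L + 2) := by
        refine Nat.add_le_add h1 ?_
        exact Nat.le_mul_of_pos_left _ h2
    _ = (L + c + 2) ^ c * (2 * L + 3) := by ring
    _ ≤ (L + c + 2) ^ c * (L + c + 2) ^ 2 := Nat.mul_le_mul_left _ h3
    _ = (L + c + 2) ^ (c + 2) := by ring

/-- The arithmetic core of `QpArith`, with the explicit constant `c' = c + 2`:
`n ^ 2 * 2 ^ ((Nat.log 2 n + c) ^ c) ≤ 2 ^ ((Nat.log 2 n + (c + 2)) ^ (c + 2))`. -/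
theorem qpArith_explicit (c n : ℕ) :
    n ^ 2 * 2 ^ ((Nat.log 2 n + c) ^ c) ≤ 2 ^ ((Nat.log 2 n + (c + 2)) ^ (c + 2)) := by
  set L := Nat.log 2 n with hL
  have hn : n < 2 ^ (L + 1) := Nat.lt_pow_succ_log_self (by norm_num) n
  have hn2 : n ^ 2 ≤ 2 ^ (2 * L + 2) := by
    calc n ^ 2 ≤ (2 ^ (L + 1)) ^ 2 := Nat.pow_le_pow_left hn.le 2
      _ = 2 ^ (2 * L + 2) := by rw [← pow_mul]; ring_nf
  calc n ^ 2 * 2 ^ ((L + c) ^ c)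
      ≤ 2 ^ (2 * L + 2) * 2 ^ ((L + c) ^ c) := Nat.mul_le_mul_right _ hn2
    _ = 2 ^ ((L + c) ^ c + (2 * L + 2)) := by rw [← pow_add, Nat.add_comm]
    _ ≤ 2 ^ ((L + (c + 2)) ^ (c + 2)) := by
        refine Nat.pow_le_pow_right (by norm_num) ?_
        simpa [Nat.add_assoc] using qpArith_exponent_le L c

/-- Settles `stmt-ValiantsHypothesis-3785` (`QpArith`) for route `FreeFermionCLL`:
`∀ c, ∃ c', ∀ n, n ^ 2 * 2 ^ ((Nat.log 2 n + c) ^ c) ≤ 2 ^ ((Nat.log 2 n + c') ^ c')`,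
witnessed by `c' = c + 2` (`qpArith_explicit`). -/
theorem qpArith_proof :
    Summit.ValiantsHypothesis.ValiantsHypothesis.Theses.FreeFermionCLL.QpArith := by
  unfold Summit.ValiantsHypothesis.ValiantsHypothesis.Theses.FreeFermionCLL.QpArith
  intro c
  exact ⟨c + 2, fun n => qpArith_explicit c n⟩

/-- The same statement as filed by route `PrincipalMinorColouring` (the two route declarations
`QpArith` are syntactically identical): settles `stmt-ValiantsHypothesis-3785` there as well. -/
theorem principalMinorColouring_qpArith_proof :
    Summit.ValiantsHypothesis.ValiantsHypothesis.Theses.PrincipalMinorColouring.QpArith := by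
  unfold Summit.ValiantsHypothesis.ValiantsHypothesis.Theses.PrincipalMinorColouring.QpArith
  intro c
  exact ⟨c + 2, fun n => qpArith_explicit c n⟩

end Summit.ValiantsHypothesis.ValiantsHypothesis.Theorems
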